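import Summits.BirchSwinnertonDyer.BirchSwinnertonDyer.Theorems.KatoDescentTamePotSupersingularCartanMuRoadDoorsTprimeFive
import Literature.NumberTheory.EllipticCurves.FineSelmerMuRoadDoorsUnconditional
import Literature.NumberTheory.EllipticCurves.DivisionFieldClassNumberInvolutionDescent
import HarnessLib

/-!
# Route `KatoDescentTamePotSupersingular` (rung K8-t′, sub-rung B4 (t′), cell `bsd-potss`): the IMAGE-FREE class-group μ-road doors WITHOUT the
# named fact Coates–Sujatha Thm. 3.4 — statement (A) at `(W, p)` and U₀ `MissingUpperBoundAt W p` on an irreducible rank-`0` (t′) row from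
# class-group integers of `ℚ(W[p])` alone (seat `bsd-potss-k8t-c4` g21; route-free; `--supports stmt-BirchSwinnertonDyer-19982 --as helper`)

HONEST FRAMING. THEOREMS ONLY (no definition, no named fact, no `sorry`); nothing is booked; items 19202 / 19982 stay OPEN at class level
(class-wide open inputs unchanged: the zeta crux 24439 and the lower half of the residual 19984); (A), Conjecture A and BSD are proved for NO
curve as a class — each door converts them, for ONE curve and ONE odd prime, into finitely many displayed integers.

WHAT CHANGED (this seat, g21). Coates–Sujatha 2005 Thm. 3.4 is now a tree theorem in the form the class-group doors consume
(`CoatesSujatha2005.fineSelmerDual_moduleFinite_of_forall_classGroupPRank_le`, `Literature/…/FineSelmerClassGroupPRankBoundedProofs`: bounded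
`rank_p Cl` along the cyclotomic tower of `ℚ(W[p])` ⟹ (A)), so the Literature doors Iwasawa 1956 / Fukuda (1) / Fukuda (2) ⟹ (A) hold with NO
named fact (`FineSelmerMuRoadDoorsUnconditional`). This file is the Summits layer: the `hCS`-FREE twins of
`CartanMuRoadDoorsTprimeFive.missingUpperBoundAt_tame_of_not_dvd_classNumber_divisionField_of_unique_prime` (k8t-c4 g18, §5) and of the
Fukuda doors, composed through the public (A)-form door `CartanMuRoadDoorsTprimeFive.missingUpperBoundAt_tame_of_conjA` (§6). Remaining named
facts on these roads: `hKatoA` (Kato 14.5 (3), fine-Selmer reading), `hGZK`, `hmod` — for U₀ only; statement (A) itself needs NONE.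

* §1 `conjA_of_not_dvd_classNumber_divisionField_of_unique_prime`, `conjA_of_unique_prime_of_involutions`,
  `conjA_of_classNumberPExp_succ_eq`, `conjA_of_classGroupPRank_succ_eq` — (A) at `(W, p)`, `p` odd, from the numerics; NO named fact.
* §2 `missingUpperBoundAt_tame_of_not_dvd_classNumber_divisionField_of_unique_prime`, `…_of_unique_prime_of_involutions`,
  `…_of_classNumberPExp_succ_eq`, `…_of_classGroupPRank_succ_eq` — U₀ on an irreducible rank-`0` (t′) row from `hKatoA hGZK hmod` + numerics.

References: [CoatesSujatha2005] Thm. 3.4 (§3); [Greenberg2001IwasawaPastPresent] Prop. 2.1; [Fukuda1994] Thm. 1; [Kato2004Asterisque] Thm. 12.5 (3),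
14.5 (3); [Washington1997] Thm. 10.4, Prop. 13.22, §13.3; [NeukirchANT1999] Ch. III §1 (1.6) (iv).
-/

set_option linter.dupNamespace false
set_option autoImplicit false

noncomputable section

open scoped Classical NumberField
open Field IntermediateField WeierstrassCurve IsDedekindDomain Literature.NumberTheory.EllipticCurves
  Literature.NumberTheory.EllipticCurves.Rank1Residual
  Literature.NumberTheory.EllipticCurves.Rank1Residual.Typed
  Literature.NumberTheory.GaloisRepresentations Literature.NumberTheory.SerreUniformity
  Literature.NumberTheory.IwasawaTheory
  Summit.BirchSwinnertonDyer.Rank1Residual Summit.BirchSwinnertonDyer.Rank1Residual.Additive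

namespace Summit.BirchSwinnertonDyer.BirchSwinnertonDyer.Theorems.ImageFreeMuRoadDoorsNoCS

/-! ## §1 Statement (A) at `(W, p)`, `p` odd, from class-group integers of `ℚ(W[p])` — NO named fact -/

section ConjA

variable (W : WeierstrassCurve ℚ) [W.IsElliptic]

/-- **(A) at `(W, p)` from the Iwasawa-1956 certificate of `ℚ(W[p])`, unconditionally** (`p` odd; `p ∤ h(ℚ(W[p]))`, exactly one prime above
`p`): the `hCS`-free twin of `DivisionFieldClassNumberDoor.conjA_of_not_dvd_classNumber_divisionField_of_unique_prime` /
`CartanMuRoadDoors.conjA_of_not_dvd_classNumber_of_unique_prime` (Literature `CoatesSujatha2005.fineSelmerDual_moduleFinite_of_not_dvd_classNumber_of_unique_prime'`).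
NO named fact; (A) for THIS curve at THIS prime from two displayed integers.
[cite: Greenberg2001IwasawaPastPresent, Prop. 2.1 p. 339] [cite: Washington1997, Thm. 10.4, Prop. 13.22] [cite: CoatesSujatha2005, Thm. 3.4 (§3)] -/
theorem conjA_of_not_dvd_classNumber_divisionField_of_unique_prime (p : ℕ) [Fact p.Prime] (hp : p ≠ 2)
    (hh : haveI : NeZero p := ⟨(Fact.out : p.Prime).ne_zero⟩
      haveI : NumberField (W.divisionField p) := NumberField.mk
      ¬ p ∣ NumberField.classNumber (W.divisionField p))
    (hv : haveI : NeZero p := ⟨(Fact.out : p.Prime).ne_zero⟩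
      haveI : NumberField (W.divisionField p) := NumberField.mk
      ∃! v : HeightOneSpectrum (𝓞 (W.divisionField p)), ((p : ℕ) : 𝓞 (W.divisionField p)) ∈ v.asIdeal)
    (κ : ZpExtension ℚ p) (hκ : κ.IsCyclotomic) :
    ∃ (γ : absoluteGaloisGroup ℚ) (D : W.FineSelmerDualData κ γ),
      Module.Finite ℤ_[p] (RestrictScalars ℤ_[p] (IwasawaAlgebra p) D.X) :=
  CoatesSujatha2005.fineSelmerDual_moduleFinite_of_not_dvd_classNumber_of_unique_prime' W p hp hh hv κ hκ

/-- **(A) at `(W, p)` from the GRH-free INVOLUTION certificate, unconditionally** (`p` odd): two index-2 subfields of `ℚ(W[p])` with class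
number prime to `p` (cut out by involutions `τ_b`, `τ_z = τ_b τ_g τ_b τ_g⁻¹` on `W[p]` — for a Cartan-normaliser image at `p = 3` the octic fields
`ℚ(P)`, `ℚ(x(W[3]))`) replace `p ∤ h(ℚ(W[p]))` (tree `DivisionField.not_dvd_classNumber_divisionField_of_involutions`); one prime of `ℚ(W[p])`
above `p`. The `hCS`-free twin of `DivisionFieldClassNumberDoor.conjA_of_unique_prime_of_involutions`. NO named fact.
[cite: NeukirchANT1999, Ch. III §1 Prop. (1.6) (iv)] [cite: Greenberg2001IwasawaPastPresent, Prop. 2.1 p. 339] [cite: CoatesSujatha2005, Thm. 3.4 (§3)] -/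
theorem conjA_of_unique_prime_of_involutions (p : ℕ) [Fact p.Prime] (hp2 : p ≠ 2) (τb τg τz : absoluteGaloisGroup ℚ)
    (hb : haveI : NeZero p := ⟨(Fact.out : p.Prime).ne_zero⟩
      ∀ T : geomTorsion W (p : ℤ), τb • (τb • T) = T)
    (hz : haveI : NeZero p := ⟨(Fact.out : p.Prime).ne_zero⟩
      ∀ T : geomTorsion W (p : ℤ), τz • (τz • T) = T)
    (hrel : haveI : NeZero p := ⟨(Fact.out : p.Prime).ne_zero⟩
      ∀ T : geomTorsion W (p : ℤ), τz • T = τb • (τg • (τb • (τg⁻¹ • T))))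
    (hKb : haveI : NeZero p := ⟨(Fact.out : p.Prime).ne_zero⟩
      haveI : NumberField (W.divisionField p) := NumberField.mk
      ¬ p ∣ NumberField.classNumber (fixedField (Subgroup.zpowers (absRestrictNormalHom (W.divisionField p) τb))))
    (hKz : haveI : NeZero p := ⟨(Fact.out : p.Prime).ne_zero⟩
      haveI : NumberField (W.divisionField p) := NumberField.mk
      ¬ p ∣ NumberField.classNumber (fixedField (Subgroup.zpowers (absRestrictNormalHom (W.divisionField p) τz))))
    (hv : haveI : NeZero p := ⟨(Fact.out : p.Prime).ne_zero⟩
      haveI : NumberField (W.divisionField p) := NumberField.mk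
      ∃! v : HeightOneSpectrum (𝓞 (W.divisionField p)), ((p : ℕ) : 𝓞 (W.divisionField p)) ∈ v.asIdeal)
    (κ : ZpExtension ℚ p) (hκ : κ.IsCyclotomic) :
    ∃ (γ : absoluteGaloisGroup ℚ) (D : W.FineSelmerDualData κ γ),
      Module.Finite ℤ_[p] (RestrictScalars ℤ_[p] (IwasawaAlgebra p) D.X) :=
  CoatesSujatha2005.fineSelmerDual_moduleFinite_of_not_dvd_classNumber_of_unique_prime' W p hp2
    (DivisionField.not_dvd_classNumber_divisionField_of_involutions W p hp2 τb τg τz hb hz hrel hKb hKz) hv κ hκ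

/-- **(A) at `(W, p)` from a Fukuda Thm. 1 (1) certificate of `L = ℚ(W[p])`, unconditionally** (`p` odd): Fukuda index `n₀ = 0` for the cyclotomic
tower of `L` and `ord_p h(L_{n+1}) = ord_p h(L_n)` for one `n` (Literature `CoatesSujatha2005.fineSelmerDual_moduleFinite_of_classNumberPExp_succ_eq'`).
NO named fact. [cite: Fukuda1994, Thm. 1 (1), p. 264] [cite: CoatesSujatha2005, Thm. 3.4 (§3)] -/
theorem conjA_of_classNumberPExp_succ_eq (p : ℕ) [Fact p.Prime] (hp : p ≠ 2) (n : ℕ)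
    (hram : haveI : NeZero p := ⟨(Fact.out : p.Prime).ne_zero⟩
      ∀ κL : ZpExtension (W.divisionField p) p, κL.IsCyclotomic → TotallyRamifiedFrom κL 0)
    (hord : haveI : NeZero p := ⟨(Fact.out : p.Prime).ne_zero⟩
      ∀ κL : ZpExtension (W.divisionField p) p, κL.IsCyclotomic →
        classNumberPExp κL (n + 1) = classNumberPExp κL n)
    (κ : ZpExtension ℚ p) (hκ : κ.IsCyclotomic) :
    ∃ (γ : absoluteGaloisGroup ℚ) (D : W.FineSelmerDualData κ γ),
      Module.Finite ℤ_[p] (RestrictScalars ℤ_[p] (IwasawaAlgebra p) D.X) :=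
  CoatesSujatha2005.fineSelmerDual_moduleFinite_of_classNumberPExp_succ_eq' W p hp n hram hord κ hκ

/-- **(A) at `(W, p)` from a Fukuda Thm. 1 (2) certificate of `L = ℚ(W[p])`, unconditionally** (`p` odd): `n₀ = 0` and
`rank_p Cl(L_{n+1}) = rank_p Cl(L_n)` for one `n` (Literature `CoatesSujatha2005.fineSelmerDual_moduleFinite_of_classGroupPRank_succ_eq'`).
NO named fact. [cite: Fukuda1994, Thm. 1 (2), p. 264] [cite: CoatesSujatha2005, Thm. 3.4 (§3)] -/
theorem conjA_of_classGroupPRank_succ_eq (p : ℕ) [Fact p.Prime] (hp : p ≠ 2) (n : ℕ)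
    (hram : haveI : NeZero p := ⟨(Fact.out : p.Prime).ne_zero⟩
      ∀ κL : ZpExtension (W.divisionField p) p, κL.IsCyclotomic → TotallyRamifiedFrom κL 0)
    (hrk : haveI : NeZero p := ⟨(Fact.out : p.Prime).ne_zero⟩
      ∀ κL : ZpExtension (W.divisionField p) p, κL.IsCyclotomic →
        classGroupPRank κL (n + 1) = classGroupPRank κL n)
    (κ : ZpExtension ℚ p) (hκ : κ.IsCyclotomic) :
    ∃ (γ : absoluteGaloisGroup ℚ) (D : W.FineSelmerDualData κ γ),
      Module.Finite ℤ_[p] (RestrictScalars ℤ_[p] (IwasawaAlgebra p) D.X) :=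
  CoatesSujatha2005.fineSelmerDual_moduleFinite_of_classGroupPRank_succ_eq' W p hp n hram hrk κ hκ

end ConjA

/-! ## §2 U₀ `MissingUpperBoundAt W p` on an irreducible rank-`0` (t′) row — `hKatoA hGZK hmod` + numerics, NO `hCS` -/

section Upper

variable (W : WeierstrassCurve ℚ) [W.IsElliptic] [W.IsGloballyMinimal]

/-- **U₀ at an irreducible rank-`0` (t′) row from two class-group integers of `ℚ(W[p])`, without Coates–Sujatha as a hypothesis**: the
`hCS`-free twin of `CartanMuRoadDoorsTprimeFive.missingUpperBoundAt_tame_of_not_dvd_classNumber_divisionField_of_unique_prime` (k8t-c4 g18 §5):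
`MissingUpperBoundAt W p` (`ord_p #Ш(W) ≤ ord_p #Ш_an(W)`) for `p` odd, `Addv W p`, `SubTprime W p`, `W[p]` irreducible, `r_an = 0`, from the named
facts `hKatoA hGZK hmod` and the numerics `p ∤ h(ℚ(W[p]))` (`hh`), one prime above `p` (`hv`). CONDITIONAL on `hKatoA hGZK hmod`; nothing
booked; BSD for no curve. [cite: Kato2004Asterisque, Thm. 14.5 (3) (p. 236), Thm. 12.5 (3) (p. 222)] [cite: CoatesSujatha2005, Thm. 3.4 (§3)]
[cite: Greenberg2001IwasawaPastPresent, Prop. 2.1 p. 339] [cite: Washington1997, Thm. 10.4, Prop. 13.22] -/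
theorem missingUpperBoundAt_tame_of_not_dvd_classNumber_divisionField_of_unique_prime
    (hKatoA : Kato2004.rankZero_padicValNat_sha_add_padicValNat_tamagawa_le_of_additive_potGood_of_irreducible_of_fineSelmerDual_fg)
    (hGZK : rank_eq_analyticRank_of_analyticRank_le_one) (hmod : hasEntireLFunction_rat) (p : ℕ) [Fact p.Prime]
    (hr : W.analyticRank = 0) (hp2 : p ≠ 2) (hadd : Addv W p) (hT : SubTprime W p) (hirr : W.HasIrreducibleModPGaloisRep p)
    (hh : haveI : NeZero p := ⟨(Fact.out : p.Prime).ne_zero⟩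
      haveI : NumberField (W.divisionField p) := NumberField.mk
      ¬ p ∣ NumberField.classNumber (W.divisionField p))
    (hv : haveI : NeZero p := ⟨(Fact.out : p.Prime).ne_zero⟩
      haveI : NumberField (W.divisionField p) := NumberField.mk
      ∃! v : HeightOneSpectrum (𝓞 (W.divisionField p)), ((p : ℕ) : 𝓞 (W.divisionField p)) ∈ v.asIdeal) :
    MissingUpperBoundAt W p :=
  CartanMuRoadDoorsTprimeFive.missingUpperBoundAt_tame_of_conjA W hKatoA hGZK hmod p hr hp2 hadd hT hirr
    (conjA_of_not_dvd_classNumber_divisionField_of_unique_prime W p hp2 hh hv)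

/-- **U₀ at an irreducible rank-`0` (t′) row from the GRH-free involution certificate of `ℚ(W[p])`, without `hCS`.**
CONDITIONAL on `hKatoA hGZK hmod`; nothing booked; BSD for no curve. [cite: Kato2004Asterisque, Thm. 14.5 (3) (p. 236)]
[cite: NeukirchANT1999, Ch. III §1 Prop. (1.6) (iv)] [cite: CoatesSujatha2005, Thm. 3.4 (§3)] -/
theorem missingUpperBoundAt_tame_of_unique_prime_of_involutions
    (hKatoA : Kato2004.rankZero_padicValNat_sha_add_padicValNat_tamagawa_le_of_additive_potGood_of_irreducible_of_fineSelmerDual_fg)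
    (hGZK : rank_eq_analyticRank_of_analyticRank_le_one) (hmod : hasEntireLFunction_rat) (p : ℕ) [Fact p.Prime]
    (hr : W.analyticRank = 0) (hp2 : p ≠ 2) (hadd : Addv W p) (hT : SubTprime W p) (hirr : W.HasIrreducibleModPGaloisRep p)
    (τb τg τz : absoluteGaloisGroup ℚ)
    (hb : haveI : NeZero p := ⟨(Fact.out : p.Prime).ne_zero⟩
      ∀ T : geomTorsion W (p : ℤ), τb • (τb • T) = T)
    (hz : haveI : NeZero p := ⟨(Fact.out : p.Prime).ne_zero⟩
      ∀ T : geomTorsion W (p : ℤ), τz • (τz • T) = T)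
    (hrel : haveI : NeZero p := ⟨(Fact.out : p.Prime).ne_zero⟩
      ∀ T : geomTorsion W (p : ℤ), τz • T = τb • (τg • (τb • (τg⁻¹ • T))))
    (hKb : haveI : NeZero p := ⟨(Fact.out : p.Prime).ne_zero⟩
      haveI : NumberField (W.divisionField p) := NumberField.mk
      ¬ p ∣ NumberField.classNumber (fixedField (Subgroup.zpowers (absRestrictNormalHom (W.divisionField p) τb))))
    (hKz : haveI : NeZero p := ⟨(Fact.out : p.Prime).ne_zero⟩
      haveI : NumberField (W.divisionField p) := NumberField.mk
      ¬ p ∣ NumberField.classNumber (fixedField (Subgroup.zpowers (absRestrictNormalHom (W.divisionField p) τz))))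
    (hv : haveI : NeZero p := ⟨(Fact.out : p.Prime).ne_zero⟩
      haveI : NumberField (W.divisionField p) := NumberField.mk
      ∃! v : HeightOneSpectrum (𝓞 (W.divisionField p)), ((p : ℕ) : 𝓞 (W.divisionField p)) ∈ v.asIdeal) :
    MissingUpperBoundAt W p :=
  CartanMuRoadDoorsTprimeFive.missingUpperBoundAt_tame_of_conjA W hKatoA hGZK hmod p hr hp2 hadd hT hirr
    (conjA_of_unique_prime_of_involutions W p hp2 τb τg τz hb hz hrel hKb hKz hv)

/-- **U₀ at an irreducible rank-`0` (t′) row from a Fukuda Thm. 1 (1) certificate of `ℚ(W[p])`, without `hCS`** (and without `hF1`, a tree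
theorem since k8t-c4 g19). CONDITIONAL on `hKatoA hGZK hmod`; nothing booked; BSD for no curve.
[cite: Kato2004Asterisque, Thm. 14.5 (3) (p. 236)] [cite: Fukuda1994, Thm. 1 (1), p. 264] [cite: CoatesSujatha2005, Thm. 3.4 (§3)] -/
theorem missingUpperBoundAt_tame_of_classNumberPExp_succ_eq
    (hKatoA : Kato2004.rankZero_padicValNat_sha_add_padicValNat_tamagawa_le_of_additive_potGood_of_irreducible_of_fineSelmerDual_fg)
    (hGZK : rank_eq_analyticRank_of_analyticRank_le_one) (hmod : hasEntireLFunction_rat) (p : ℕ) [Fact p.Prime]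
    (hr : W.analyticRank = 0) (hp2 : p ≠ 2) (hadd : Addv W p) (hT : SubTprime W p) (hirr : W.HasIrreducibleModPGaloisRep p) (n : ℕ)
    (hram : haveI : NeZero p := ⟨(Fact.out : p.Prime).ne_zero⟩
      ∀ κL : ZpExtension (W.divisionField p) p, κL.IsCyclotomic → TotallyRamifiedFrom κL 0)
    (hord : haveI : NeZero p := ⟨(Fact.out : p.Prime).ne_zero⟩
      ∀ κL : ZpExtension (W.divisionField p) p, κL.IsCyclotomic →
        classNumberPExp κL (n + 1) = classNumberPExp κL n) :
    MissingUpperBoundAt W p :=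
  CartanMuRoadDoorsTprimeFive.missingUpperBoundAt_tame_of_conjA W hKatoA hGZK hmod p hr hp2 hadd hT hirr
    (conjA_of_classNumberPExp_succ_eq W p hp2 n hram hord)

/-- **U₀ at an irreducible rank-`0` (t′) row from a Fukuda Thm. 1 (2) certificate of `ℚ(W[p])`, without `hCS`** (and without `hF2`, a tree
theorem since k8t-c4 g20). CONDITIONAL on `hKatoA hGZK hmod`; nothing booked; BSD for no curve.
[cite: Kato2004Asterisque, Thm. 14.5 (3) (p. 236)] [cite: Fukuda1994, Thm. 1 (2), p. 264] [cite: CoatesSujatha2005, Thm. 3.4 (§3)] -/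
theorem missingUpperBoundAt_tame_of_classGroupPRank_succ_eq
    (hKatoA : Kato2004.rankZero_padicValNat_sha_add_padicValNat_tamagawa_le_of_additive_potGood_of_irreducible_of_fineSelmerDual_fg)
    (hGZK : rank_eq_analyticRank_of_analyticRank_le_one) (hmod : hasEntireLFunction_rat) (p : ℕ) [Fact p.Prime]
    (hr : W.analyticRank = 0) (hp2 : p ≠ 2) (hadd : Addv W p) (hT : SubTprime W p) (hirr : W.HasIrreducibleModPGaloisRep p) (n : ℕ)
    (hram : haveI : NeZero p := ⟨(Fact.out : p.Prime).ne_zero⟩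
      ∀ κL : ZpExtension (W.divisionField p) p, κL.IsCyclotomic → TotallyRamifiedFrom κL 0)
    (hrk : haveI : NeZero p := ⟨(Fact.out : p.Prime).ne_zero⟩
      ∀ κL : ZpExtension (W.divisionField p) p, κL.IsCyclotomic →
        classGroupPRank κL (n + 1) = classGroupPRank κL n) :
    MissingUpperBoundAt W p :=
  CartanMuRoadDoorsTprimeFive.missingUpperBoundAt_tame_of_conjA W hKatoA hGZK hmod p hr hp2 hadd hT hirr
    (conjA_of_classGroupPRank_succ_eq W p hp2 n hram hrk)

end Upper

end Summit.BirchSwinnertonDyer.BirchSwinnertonDyer.Theorems.ImageFreeMuRoadDoorsNoCS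

end
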